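import Summits.CriticalPhenomena.PercolationContinuityZ3.Theorems.PercNearOneGluingNoHeavyPcintVdBEStepDominationRoot
import HarnessLib

/-!
# PCINT lane, king route, K1 step (3): van den Berg–Ermakov's `ξ`-process dominates `π_q` step-wise

Cell `prim-pcint`, seat `prim-pcint-1` (gen 10); memo `run/shared/lean/prim/pcint/KING-ROUTE.md` §K1 (3).

**Theorem (`VdBEMarkov.dominating`).**  On every finite `Λ ⊆ ℤ²` with root `o`, van den Berg–Ermakov's oracle with
the root rule `ε(o) = (1,1)` (`VdBEProcess11.outVdBE11`), run with the cluster exploration `ClusterExpl.rule`, under the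
pair-state prior at `p = 0.444` CONDITIONED on `ε(o) = (1,1)` (`muR`), is step-wise dominating for `π_q`, `q = 0.556`:

  `AdaptDom.Dominating (556/1000) (ClusterExpl.rule (boxGraph Λ) enc o) (muR Λ o) (outVdBE11 Λ enc)`.

This discharges hypothesis `hdom` of `AdaptDom.expect_le_of_dominating` (K1 step (3) of the memo).  Cases of a step
`(n, σ)`: `n = 0`; unreachable `σ`; no selected site; the selected site is the root (a product law with marginals
`1 - 0.556² ≥ 0.556`, `AdaptDom.sum_wt_le_sum_pw_pat`); the selected site `b₂ ≠ o` was examined by the root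
(`StepCtx.inner_dominance_root`) or by a site `c ≠ o` (`StepCtx.DCtx.inner_dominance`), via the fibre factorisation
and `AdaptDom.dominance_of_factorisation`.
-/

namespace Summit.CriticalPhenomena.PercolationContinuityZ3.Theorems.Pcint

open Finset

/-! ### Product patterns with large marginals dominate `π_q` -/

namespace AdaptDom

variable {V : Type*} [Fintype V] [DecidableEq V] {S : Type*} [Fintype S] [DecidableEq S]

omit [DecidableEq S] in
/-- **Coordinatewise comparison on the cube**: if the pattern `v ↦ ψ v (u v)` (`v ∈ T`, `false` elsewhere) of a
`pw m`-distributed `u` has every marginal `P(ψ v (u v)) ≥ q`, then for every step test function `g` of `T`,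
`E_{π_q}[g] ≤ E[g(pattern)]`. -/
theorem sum_wt_le_sum_pw_pat (m : S → ℝ) (hm0 : ∀ s, 0 ≤ m s) (hm1 : ∑ s, m s = 1) {q : ℝ} (hq0 : 0 ≤ q) (hq1 : q ≤ 1)
    (ψ : V → S → Bool) (T : Finset V) (hr : ∀ v ∈ T, q ≤ ∑ s ∈ univ.filter (fun s => ψ v s = true), m s)
    (g : (V → Bool) → ℝ) (hg : StepTest T g) :
    ∑ ω : V → Bool, wt q ω * g ω ≤ ∑ u : V → S, pw (fun _ => m) u * g (fun v => if v ∈ T then ψ v (u v) else false) := by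
  induction T using Finset.induction_on generalizing g with
  | empty =>
    have hc : ∀ x : V → Bool, g x = g (fun _ => false) := fun x => hg.2 _ _ fun v hv => absurd hv (by simp)
    simp only [Finset.notMem_empty, if_false]
    rw [Finset.sum_congr rfl fun ω _ => by rw [hc ω], ← Finset.sum_mul, sum_wt, one_mul, ← Finset.sum_mul,
      sum_pw (fun _ => hm1), one_mul]
  | insert a T haT ih =>
    -- the pattern after resampling `a`
    have hpat : ∀ (u : V → S) (s : S), (fun v => if v ∈ insert a T then ψ v (Function.update u a s v) else false) =
        Function.update (fun v => if v ∈ T then ψ v (u v) else false) a (ψ a s) := by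
      intro u s; funext v
      by_cases hva : v = a
      · subst hva; simp
      · rw [Function.update_of_ne hva, Function.update_of_ne hva]
        simp [Finset.mem_insert, hva]
    -- `g` with the coordinate `a` frozen is a step test function of `T`
    have hgb : ∀ b : Bool, StepTest T (fun x => g (Function.update x a b)) := by
      intro b
      refine ⟨fun x x' h => hg.1 _ _ fun v hv => ?_, fun x x' h => hg.2 _ _ fun v hv => ?_⟩ <;>
      · by_cases hva : v = a
        · subst hva; simp
        · rw [Function.update_of_ne hva, Function.update_of_ne hva]
          rcases Finset.mem_insert.1 hv with h' | h'
          · exact absurd h' hva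
          · exact h v h'
    -- resample `a` on the right
    rw [sum_pw_resample (fun _ => m) (fun _ => hm1) a]
    simp_rw [hpat]
    -- compare the one-site laws, then use the induction hypothesis
    have hmq1 : ∀ v : V, ∑ b, (fun (_ : V) (b : Bool) => bern q b) v b = 1 := fun _ => sum_bern q
    have step : ∀ u : V → S, ∑ b, bern q b * g (Function.update (fun v => if v ∈ T then ψ v (u v) else false) a b) ≤
        ∑ s, m s * g (Function.update (fun v => if v ∈ T then ψ v (u v) else false) a (ψ a s)) := by
      intro u
      set x := (fun v => if v ∈ T then ψ v (u v) else false) with hx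
      have hgroup : ∑ s, m s * g (Function.update x a (ψ a s)) =
          ∑ b, lawB (fun (_ : V) => m) ψ (some a) b * g (Function.update x a b) := by
        rw [Fintype.sum_bool]
        simp only [lawB, Finset.sum_mul]
        rw [← Finset.sum_filter_add_sum_filter_not univ (fun s => ψ a s = true)]
        congr 1
        · exact Finset.sum_congr rfl fun s hs => by rw [(Finset.mem_filter.1 hs).2]
        · refine Finset.sum_congr (by ext s; simp) fun s hs => ?_
          have : ψ a s = false := by simpa using (Finset.mem_filter.1 hs).2
          rw [this]
      rw [hgroup]
      refine sum_bool_mono_law (lawB (fun (_ : V) => m) ψ (some a)) (fun b => bern q b)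
        (sum_lawB _ (fun _ => hm1) ψ (some a)) (sum_bern q) ?_ _ ?_
      · simpa [lawB, bern] using hr a (Finset.mem_insert_self a T)
      · exact hg.1 _ _ fun v _ => by
          by_cases hva : v = a
          · subst hva; simp
          · rw [Function.update_of_ne hva, Function.update_of_ne hva]
    calc ∑ ω : V → Bool, wt q ω * g ω
        = ∑ ω : V → Bool, wt q ω * ∑ b, bern q b * g (Function.update ω a b) :=
          sum_pw_resample (fun (_ : V) (b : Bool) => bern q b) hmq1 a g
      _ = ∑ b, bern q b * ∑ ω : V → Bool, wt q ω * g (Function.update ω a b) := by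
          simp_rw [Finset.mul_sum]; rw [Finset.sum_comm]
          exact Finset.sum_congr rfl fun b _ => Finset.sum_congr rfl fun ω _ => by simp only [wt]; ring
      _ ≤ ∑ b, bern q b * ∑ u : V → S, pw (fun _ => m) u *
            g (Function.update (fun v => if v ∈ T then ψ v (u v) else false) a b) :=
          Finset.sum_le_sum fun b _ => mul_le_mul_of_nonneg_left
            (ih (fun v hv => hr v (Finset.mem_insert_of_mem hv)) (fun x => g (Function.update x a b)) (hgb b))
            (bern_nonneg hq0 hq1 b)
      _ = ∑ u : V → S, pw (fun _ => m) u *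
            ∑ b, bern q b * g (Function.update (fun v => if v ∈ T then ψ v (u v) else false) a b) := by
          simp_rw [Finset.mul_sum]; rw [Finset.sum_comm]
          exact Finset.sum_congr rfl fun u _ => Finset.sum_congr rfl fun b _ => by ring
      _ ≤ ∑ u : V → S, pw (fun _ => m) u *
            ∑ s, m s * g (Function.update (fun v => if v ∈ T then ψ v (u v) else false) a (ψ a s)) :=
          Finset.sum_le_sum fun u _ => mul_le_mul_of_nonneg_left (step u) (pw_nonneg (fun _ s => hm0 s) u)

end AdaptDom

namespace VdBEMarkov

open AdaptDom ClusterExpl VdBEProcess VdBEProcess11 VdBELocal Literature.Probability.LatticeModels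

variable {Λ : Finset (Site 2)} (enc : ↥Λ → ℕ) (o : ↥Λ)

/-! ### The weight: pair-state prior conditioned on `ε(o) = (1,1)` -/

/-- **The weight of the king route**: the pair-state prior at `p = 0.444`, conditioned on both sites of the pair of
the root being open. -/
noncomputable def muR (Λ : Finset (Site 2)) (o : ↥Λ) (w : ↥Λ → PState) : ℝ :=
  pw (fun _ => mP) w * (if w o = (true, true) then 1 else 0) / mP (true, true)

/-- `mP (1,1) = 0.444² > 0`. -/
theorem mP_tt_pos : 0 < mP (true, true) := by norm_num [mP, bern]

variable {enc o}
/-- `muR ≥ 0`. -/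
theorem muR_nonneg (w : ↥Λ → PState) : 0 ≤ muR Λ o w :=
  div_nonneg (mul_nonneg (pw_nonneg (fun _ s => mP_nonneg s) w) (by split_ifs <;> norm_num)) mP_tt_pos.le

/-- `muR` is a probability. -/
theorem sum_muR : ∑ w, muR Λ o w = 1 := by
  unfold muR
  rw [← Finset.sum_div]
  have h := sum_pw_mul_blind (fun (_ : ↥Λ) => mP) (fun _ => sum_mP) o
    (fun s => if s = (true, true) then (1 : ℝ) else 0) (fun _ => 1) (fun _ _ => rfl)
  simp only [mul_one] at h
  rw [h, sum_pw (fun _ => sum_mP), mul_one]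
  have : ∑ s : PState, mP s * (if s = (true, true) then (1 : ℝ) else 0) = mP (true, true) := by
    rw [Finset.sum_eq_single (true, true) (fun s _ hs => by rw [if_neg hs, mul_zero]) (by simp)]; simp
  rw [this, div_self mP_tt_pos.ne']

/-- On the fibre of a state of step `n ≥ 1`, the root factor of `muR` is the constant `[σ o = tt]`. -/
theorem root_factor_of_fib {n : ℕ} (hn : 0 < n) {σ : ↥Λ → Option Bool} {w : ↥Λ → PState} (h : Fib enc o n σ w) :
    (if w o = (true, true) then (1 : ℝ) else 0) = if (σ o).getD false = true then 1 else 0 := by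
  have h0 := h 0 hn o (root_mem_rule_zero enc o σ)
  rw [outVdBE11_init enc w (show ∀ v, traj enc o σ 0 v = none from fun _ => rfl)] at h0
  by_cases hw : w o = (true, true)
  · rw [if_pos hw, if_pos]; rw [← h0]; exact decide_eq_true hw
  · rw [if_neg hw, if_neg]; rw [← h0]; simp [hw]

section Origin

variable {n : ℕ} {σ : ↥Λ → Option Bool} (hcons : traj enc o σ n = σ) (hsel : sel (boxGraph Λ) enc σ = some o)
include hcons hsel

/-- The fibre tests of the origin step other than the root test do not read the root or its children. -/
theorem fib_origin_mixG_iff (u w : ↥Λ → PState) :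
    Fib enc o n σ (mixG (insert o (rule (boxGraph Λ) enc o σ)) u w) ↔
      (∀ k < n, ∀ a ∈ rule (boxGraph Λ) enc o (traj enc o σ k), k ≠ 0 →
        outVdBE11 Λ enc w (traj enc o σ k) a = (σ a).getD false) ∧ u o = (true, true) := by
  have hn : 0 < n := by
    refine Nat.pos_of_ne_zero fun hn0 => ?_
    subst hn0
    have h1 := (sel_revealedTrue (boxGraph Λ) enc hsel).1
    rw [← hcons] at h1; exact absurd h1 (by simp [traj, run])
  have hσo : σ o = some true := (sel_revealedTrue (boxGraph Λ) enc hsel).1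
  set W := insert o (rule (boxGraph Λ) enc o σ) with hW
  -- sites examined or selected at a step `1 ≤ k < n` are outside `W`
  have hC : ∀ a ∈ rule (boxGraph Λ) enc o σ, σ a = none := fun a ha => rule_unrevealed (boxGraph Λ) enc o σ a ha
  have key : ∀ k < n, ∀ a ∈ rule (boxGraph Λ) enc o (traj enc o σ k), k ≠ 0 →
      outVdBE11 Λ enc (mixG W u w) (traj enc o σ k) a = outVdBE11 Λ enc w (traj enc o σ k) a := by
    intro k hk a ha hk0
    have hne : ¬ ∀ v, traj enc o σ k v = none := by
      obtain ⟨k', rfl⟩ := Nat.exists_eq_add_of_le' (Nat.pos_of_ne_zero hk0)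
      exact not_initial_run_succ (boxGraph Λ) enc o (readOut σ) k'
    have haW : a ∉ W := by
      rw [hW, Finset.mem_insert]
      rintro (hao | haC)
      · rw [hao] at ha
        exact hk0 (step_unique_of_mem_rule (boxGraph Λ) enc o (readOut σ) ha (root_mem_rule_zero enc o σ))
      · have h0 := hC a haC
        rw [← hcons] at h0
        exact not_mem_rule_of_run_apply_eq_none (boxGraph Λ) enc o (readOut σ) hk h0 ha
    cases hs : sel (boxGraph Λ) enc (traj enc o σ k) with
    | none => rw [outVdBE11_none enc _ hne hs, outVdBE11_none enc _ hne hs]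
    | some b =>
      have hbW : b ∉ W := by
        rw [hW, Finset.mem_insert]
        rintro (hbo | hbC)
        · have h1 := sel_ne_of_sel_eq (boxGraph Λ) enc o (readOut σ) hne hs hk
          rw [hbo] at h1
          exact h1 (show sel (boxGraph Λ) enc (traj enc o σ n) = some o by rw [hcons]; exact hsel)
        · have h0 := hC b hbC
          rw [← hcons] at h0
          exact sel_ne_of_run_apply_eq_none (boxGraph Λ) enc o (readOut σ) hk.le h0 hs
      have hab : (zdGraph 2).Adj a.1 b.1 := by
        rw [rule_eq_filter_of_sel (boxGraph Λ) enc o hne hs, mem_filter] at ha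
        exact ((boxGraph_adj Λ).1 ha.2.1).symm
      rw [outVdBE11_sel enc _ hne hs hab, outVdBE11_sel enc _ hne hs hab, mixG_of_not_mem haW, mixG_of_not_mem hbW]
  have h00 : ∀ v, traj enc o σ 0 v = none := fun _ => rfl
  constructor
  · intro h
    refine ⟨fun k hk a ha hk0 => by rw [← key k hk a ha hk0]; exact h k hk a ha, ?_⟩
    have h0 := h 0 hn o (root_mem_rule_zero enc o σ)
    rw [outVdBE11_init enc _ h00, mixG_of_mem (Finset.mem_insert_self _ _), hσo] at h0
    exact of_decide_eq_true h0
  · rintro ⟨h, ho⟩ k hk a ha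
    by_cases hk0 : k = 0
    · subst hk0
      have hao : a = o := by
        have h1 : rule (boxGraph Λ) enc o (traj enc o σ 0) = {o} := by rw [rule, if_pos h00]
        rw [h1, Finset.mem_singleton] at ha; exact ha
      subst hao
      rw [outVdBE11_init enc _ h00, mixG_of_mem (Finset.mem_insert_self _ _), hσo]
      exact decide_eq_true ho
    · rw [key k hk a ha hk0]; exact h k hk a ha hk0

omit hcons in
/-- **Per-state domination at the origin step.** -/
theorem origin_dominance {g : (↥Λ → Bool) → ℝ} (hg : StepTest (rule (boxGraph Λ) enc o σ) g) :
    (∑ u : ↥Λ → PState, pw (fun _ => mP) u * (if u o = (true, true) then (1 : ℝ) else 0)) *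
        (∑ ω : ↥Λ → Bool, wt (556 / 1000) ω * g ω) ≤
      ∑ u : ↥Λ → PState, pw (fun _ => mP) u * ((if u o = (true, true) then (1 : ℝ) else 0) *
        g (fun v => if v ∈ rule (boxGraph Λ) enc o σ then etaB v.1 o.1 (u v) (u o) else false)) := by
  set C := rule (boxGraph Λ) enc o σ with hC
  have hoC : o ∉ C := fun h => by
    have := rule_unrevealed (boxGraph Λ) enc o σ o h
    rw [(sel_revealedTrue (boxGraph Λ) enc hsel).1] at this; exact absurd this (by simp)
  -- resample the root
  have hm1 : ∀ v : ↥Λ, ∑ s, (fun (_ : ↥Λ) => mP) v s = 1 := fun _ => sum_mP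
  have eM : ∑ u : ↥Λ → PState, pw (fun _ => mP) u * (if u o = (true, true) then (1 : ℝ) else 0) = mP (true, true) := by
    have h := sum_pw_mul_blind (fun (_ : ↥Λ) => mP) hm1 o (fun s => if s = (true, true) then (1 : ℝ) else 0)
      (fun _ => 1) (fun _ _ => rfl)
    simp only [mul_one] at h
    rw [h, sum_pw hm1, mul_one, Finset.sum_eq_single (true, true) (fun s _ hs => by rw [if_neg hs, mul_zero]) (by simp)]
    simp
  have eR : ∑ u : ↥Λ → PState, pw (fun _ => mP) u * ((if u o = (true, true) then (1 : ℝ) else 0) *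
      g (fun v => if v ∈ C then etaB v.1 o.1 (u v) (u o) else false)) =
      mP (true, true) * ∑ u : ↥Λ → PState, pw (fun _ => mP) u *
        g (fun v => if v ∈ C then etaB v.1 o.1 (u v) (true, true) else false) := by
    rw [sum_pw_resample (fun _ => mP) hm1 o]
    have inner : ∀ u : ↥Λ → PState, ∑ s, mP s * ((if Function.update u o s o = (true, true) then (1 : ℝ) else 0) *
        g (fun v => if v ∈ C then etaB v.1 o.1 (Function.update u o s v) (Function.update u o s o) else false)) =
        mP (true, true) * g (fun v => if v ∈ C then etaB v.1 o.1 (u v) (true, true) else false) := by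
      intro u
      rw [Finset.sum_eq_single (true, true) (fun s _ hs => by rw [Function.update_self, if_neg hs]; ring) (by simp)]
      rw [Function.update_self, if_pos rfl, one_mul]
      congr 2
      funext v
      by_cases hv : v ∈ C
      · rw [if_pos hv, if_pos hv, Function.update_of_ne (ne_of_mem_of_not_mem hv hoC)]
      · rw [if_neg hv, if_neg hv]
    simp_rw [inner]
    rw [Finset.mul_sum]
    exact Finset.sum_congr rfl fun u _ => by ring
  rw [eM, eR]
  refine mul_le_mul_of_nonneg_left ?_ mP_tt_pos.le
  -- product pattern with marginals `1 - 0.556² ≥ 0.556`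
  refine sum_wt_le_sum_pw_pat mP mP_nonneg sum_mP (by norm_num) (by norm_num)
    (fun (v : ↥Λ) (s : PState) => etaB v.1 o.1 s (true, true)) C (fun v _ => ?_) g hg
  have : ∀ s : PState, etaB v.1 o.1 s (true, true) = !(s == (false, false)) := by
    rintro ⟨a, b⟩; unfold etaB; split_ifs <;> cases a <;> cases b <;> rfl
  simp only [this, Fintype.sum_prod_type, Finset.sum_filter, Fintype.sum_bool, mP, bern]
  norm_num

end Origin

open Classical in
/-- Fibre sums of `muR` at a step `n ≥ 1`: the root factor is constant on the fibre. -/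
theorem sum_fib_muR {n : ℕ} (hn : 0 < n) {σ : ↥Λ → Option Bool} (hcons : traj enc o σ n = σ) (F : (↥Λ → PState) → ℝ) :
    ∑ w ∈ univ.filter (fun w => run (rule (boxGraph Λ) enc o) (outVdBE11 Λ enc w) n = σ), muR Λ o w * F w =
      (if (σ o).getD false = true then (1 : ℝ) else 0) / mP (true, true) *
        ∑ w, pw (fun _ => mP) w * ((if Fib enc o n σ w then (1 : ℝ) else 0) * F w) := by
  classical
  rw [Finset.sum_filter, Finset.mul_sum]
  refine Finset.sum_congr rfl fun w _ => ?_
  by_cases h : Fib enc o n σ w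
  · rw [if_pos ((run_eq_iff_fib enc o n σ w).2 ⟨hcons, h⟩), if_pos h, muR, root_factor_of_fib hn h]; ring
  · rw [if_neg (fun h' => h ((run_eq_iff_fib enc o n σ w).1 h').2), if_neg h]; ring

/-- **K1 step (3): van den Berg–Ermakov's `ξ`-process (root rule `ε(o) = (1,1)`, prior conditioned on it) dominates
`π_{0.556}` step-wise along the cluster exploration.** -/
theorem dominating (enc : ↥Λ → ℕ) (o : ↥Λ) :
    Dominating (556 / 1000) (rule (boxGraph Λ) enc o) (muR Λ o) (outVdBE11 Λ enc) := by
  classical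
  intro n σ g hg
  have hwt1 : ∑ ω : ↥Λ → Bool, wt (556 / 1000 : ℝ) ω = 1 := sum_wt _
  rcases Nat.eq_zero_or_pos n with rfl | hn
  · -- the root step
    by_cases hσ : σ = fun _ => none
    · subst hσ
      have hR : rule (boxGraph Λ) enc o (fun _ => none) = {o} := by rw [rule, if_pos (fun _ => rfl)]
      have hfib : (univ.filter fun w : ↥Λ → PState => run (rule (boxGraph Λ) enc o) (outVdBE11 Λ enc w) 0 = fun _ => none)
          = univ := by ext w; simp [run]
      rw [hfib, sum_muR, one_mul]
      -- every configuration is below `true` on `{o}`; on the support of `muR` the root reports `true`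
      have hle : ∀ ω : ↥Λ → Bool, g ω ≤ g (fun _ => true) := fun ω => hg.1 _ _ fun v _ => Bool.le_true _
      have hval : ∀ w : ↥Λ → PState, muR Λ o w * g (outVdBE11 Λ enc w (fun _ => none)) = muR Λ o w * g (fun _ => true) := by
        intro w
        by_cases hw : w o = (true, true)
        · refine congrArg _ (hg.2 _ _ fun v hv => ?_)
          rw [hR, Finset.mem_singleton] at hv; subst hv
          rw [outVdBE11_init enc w (fun _ => rfl)]; exact decide_eq_true hw
        · simp [muR, hw]
      rw [Finset.sum_congr rfl fun w _ => hval w, ← Finset.sum_mul, sum_muR, one_mul]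
      calc ∑ ω : ↥Λ → Bool, wt (556 / 1000) ω * g ω ≤ ∑ ω : ↥Λ → Bool, wt (556 / 1000) ω * g (fun _ => true) :=
            Finset.sum_le_sum fun ω _ => mul_le_mul_of_nonneg_left (hle ω) (wt_nonneg (by norm_num) (by norm_num) ω)
        _ = g (fun _ => true) := by rw [← Finset.sum_mul, hwt1, one_mul]
    · have hfib : (univ.filter fun w : ↥Λ → PState => run (rule (boxGraph Λ) enc o) (outVdBE11 Λ enc w) 0 = σ) = ∅ := by
        ext w; simp only [Finset.mem_filter, Finset.mem_univ, true_and, Finset.notMem_empty, iff_false]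
        exact fun h => hσ (h ▸ rfl)
      rw [hfib]; simp
  -- a genuine step
  by_cases hcons : traj enc o σ n = σ
  swap
  · have hfib : (univ.filter fun w : ↥Λ → PState => run (rule (boxGraph Λ) enc o) (outVdBE11 Λ enc w) n = σ) = ∅ := by
      ext w; simp only [Finset.mem_filter, Finset.mem_univ, true_and, Finset.notMem_empty, iff_false]
      exact fun h => hcons ((run_eq_iff_fib enc o n σ w).1 h).1
    rw [hfib]; simp
  have hne : ¬ ∀ v, σ v = none := by
    obtain ⟨n', rfl⟩ := Nat.exists_eq_add_of_le' hn; rw [← hcons]; exact not_initial_run_succ (boxGraph Λ) enc o (readOut σ) n'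
  rw [show (∑ w ∈ univ.filter (fun w => run (rule (boxGraph Λ) enc o) (outVdBE11 Λ enc w) n = σ), muR Λ o w) =
      ∑ w ∈ univ.filter (fun w => run (rule (boxGraph Λ) enc o) (outVdBE11 Λ enc w) n = σ), muR Λ o w * 1 by
    simp only [mul_one]]
  rw [sum_fib_muR hn hcons (fun _ => 1), sum_fib_muR hn hcons]
  simp only [mul_one]
  rw [mul_assoc]
  refine mul_le_mul_of_nonneg_left ?_ (div_nonneg (by split_ifs <;> norm_num) mP_tt_pos.le)
  -- it remains to dominate with the weight `pw · 𝟙[Fib]`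
  cases hsel : sel (boxGraph Λ) enc σ with
  | none =>
    -- nothing is examined: `g` is constant
    have hR := rule_eq_empty_of_sel_eq_none (boxGraph Λ) enc o hne hsel
    have hc : ∀ x : ↥Λ → Bool, g x = g (fun _ => false) := fun x => hg.2 _ _ fun v hv => by
      rw [hR] at hv; exact absurd hv (by simp)
    have e1 : ∑ ω : ↥Λ → Bool, wt (556 / 1000) ω * g ω = g (fun _ => false) := by
      rw [Finset.sum_congr rfl fun ω _ => by rw [hc ω], ← Finset.sum_mul, hwt1, one_mul]
    rw [e1, Finset.sum_mul]
    refine le_of_eq (Finset.sum_congr rfl fun w _ => ?_)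
    rw [hc (outVdBE11 Λ enc w σ)]; ring
  | some b₂ =>
    by_cases hb₂o : b₂ = o
    · -- the origin step
      rw [hb₂o] at hsel
      set W := insert o (rule (boxGraph Λ) enc o σ)
      have hG : ∀ u w : ↥Λ → PState, u o = (true, true) → g (outVdBE11 Λ enc (mixG W u w) σ) =
          g (fun v => if v ∈ rule (boxGraph Λ) enc o σ then etaB v.1 o.1 (u v) (u o) else false) := by
        intro u w _
        refine hg.2 _ _ fun a ha => ?_
        have hab : (zdGraph 2).Adj a.1 o.1 := by
          have h := ha
          rw [rule_eq_filter_of_sel (boxGraph Λ) enc o hne hsel, mem_filter] at h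
          exact ((boxGraph_adj Λ).1 h.2.1).symm
        rw [if_pos ha, outVdBE11_sel enc _ hne hsel hab, mixG_of_mem (Finset.mem_insert_of_mem ha),
          mixG_of_mem (Finset.mem_insert_self _ _)]
      exact dominance_of_factorisation (fun _ => mP) (fun _ => sum_mP) (fun _ s => mP_nonneg s) W
        (Fib enc o n σ) _ (fun u _ => u o = (true, true)) (fib_origin_mixG_iff hcons hsel) _ _ hG _
        (fun _ => origin_dominance hsel hg)
    · -- `b₂ ≠ o`: the examiner `c` of `b₂`
      have hb₂ : traj enc o σ n b₂ ≠ none := by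
        rw [hcons, (sel_revealedTrue (boxGraph Λ) enc hsel).1]; simp
      obtain ⟨k₀, hk₀, c, -, hselc, -, hb₂R, -⟩ := exists_examiner (boxGraph Λ) enc o (readOut σ) hb₂ hb₂o
      let X : StepCtx enc o := ⟨n, σ, b₂, k₀, c, hcons, hsel, hk₀, hselc, hb₂R⟩
      have hGK : ∀ u w : ↥Λ → PState, g (outVdBE11 Λ enc (mixG X.W₀ u w) σ) = X.K g u := by
        intro u w
        refine hg.2 _ _ fun a ha => ?_
        have haW : a ∈ X.W₀ := X.mem_W₀.2 (Or.inr (Or.inr (Or.inl ha)))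
        have hb₂W : X.b₂ ∈ X.W₀ := X.mem_W₀.2 (Or.inl rfl)
        change outVdBE11 Λ enc (mixG X.W₀ u w) σ a = (if a ∈ X.C then etaB a.1 X.b₂.1 (u a) (u X.b₂) else false)
        rw [if_pos (show a ∈ X.C from ha), outVdBE11_sel enc _ hne hsel (X.mem_C ha).2.symm, mixG_of_mem haW,
          mixG_of_mem hb₂W]
      by_cases hco : c = o
      · -- examined by the root
        refine dominance_of_factorisation X.mPV X.mPV_sum (fun _ s => mP_nonneg s) X.W₀ (Fib enc o n σ) X.FibRest
          X.PsiR (X.fib_mixG_iff_root' hco) _ (X.K g) (fun u w _ => hGK u w) _ fun w => ?_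
        simp_rw [X.ind_PsiR]
        have := X.inner_dominance_root hg w
        simpa only [mul_assoc] using this
      · -- examined by `c ≠ o`, itself examined by `d`
        have hcn : traj enc o σ k₀ c ≠ none := by rw [X.traj_c]; simp
        obtain ⟨k₁, hk₁, d, -, hseld, -, hcR, -⟩ := exists_examiner (boxGraph Λ) enc o (readOut σ) hcn hco
        let D : X.DCtx := ⟨k₁, d, hk₁, hseld, hcR⟩
        refine dominance_of_factorisation X.mPV X.mPV_sum (fun _ s => mP_nonneg s) X.W₀ (Fib enc o n σ) X.FibRest
          D.PsiA D.fib_mixG_iff' _ (X.K g) (fun u w _ => hGK u w) _ fun w => ?_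
        simp_rw [D.ind_PsiA]
        have := D.inner_dominance hg w
        simpa only [mul_assoc] using this

end VdBEMarkov

end Summit.CriticalPhenomena.PercolationContinuityZ3.Theorems.Pcint
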